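import Mathlib
import HarnessLib
import HarnessLib.Audit
import Summits.HubbardSuperconductivity.Statement

/-!
# Promotion package, part 1 — the physics stub `stub_conicalCore` in ROUTE vocabulary

Crux stmt-HubbardSuperconductivity-10370 `NodalDiracWeakCoupling` (route NodalDiracTwist), line `birth`,
lead c10. This file has EXACTLY the imports of the gate-written route file
`Summits/HubbardSuperconductivity/HubbardSuperconductivity/Theses/NodalDiracTwist.lean` and states the
registered stub `stub_conicalCore` with the route's inlined `let sh / let a / let H` (no
`spinTwistedHubbardTorus`, no Theorems-side import), so the planner can file it verbatim as a route item
(`NodalDiracCone`, say) with `ledger route edit`. Part 2 (`NodalDiracConePromotion.lean`) proves, against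
the tree, that this text is definitionally the registered stub and that the landed glue
`nodalDiracWeakCoupling_of_conicalCore` closes 10370 from it.
-/

-- the mandated namespace repeats `HubbardSuperconductivity` (single-problem summit, D-0017)
set_option linter.dupNamespace false

namespace Summit.HubbardSuperconductivity.HubbardSuperconductivity.Theses.NodalDiracTwist.PromotionCheck

open scoped BigOperators Matrix

/-- Candidate route item (decl `NodalDiracCone`): NodalDirac CONES at arbitrarily weak repulsion, in the
`D₄`-reduced ONE-POINT form — `∀ U₀ > 0 ∃ U ∈ (0, U₀) ∃ δ ∈ [1/10, 3/10] ∃ κ` (`0 < κ < π`, `cos κ ≠ 0`)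
such that for every `ε > 0` and all large even non-resonant `L` there is `c ∈ (0, π)` with
`|cos c - cos (Lκ)| ≤ ε` and, for `N = 2⌊(1-δ)L²/2⌋` and the boost-gauge spin-twisted torus `H(φ)`:
(i) LOCUS on the closed triangle `0 ≤ φ₁ ≤ φ₀ ≤ π`: the `(N, S^z = 0)`-sector ground state of `H(φ)`
admits an orthogonal pair iff `φ = (c, c)`; (ii) at `(c, c)` the sector ground space is exactly
two-dimensional; (iii) CONE at `(c, c)`: for some `m, ρ > 0`, at every `φ` with `0 < |φ - (c,c)| ≤ ρ`
every unit sector vector orthogonal to a ground state has energy `≥ minEnergyOn + m |φ - (c,c)|`. -/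
def NodalDiracCone : Prop :=
  ∀ U₀ : ℝ, 0 < U₀ → ∃ U ∈ Set.Ioo (0 : ℝ) U₀, ∃ δ ∈ Set.Icc (1 / 10 : ℝ) (3 / 10), (∃ κ : ℝ, 0 < κ ∧ κ < Real.pi ∧ Real.cos κ ≠ 0 ∧ ∀ ε : ℝ, 0 < ε → ∃ L₀ : ℕ, ∀ (L : ℕ) [NeZero L], Even L → L₀ ≤ L → (∀ m : ℤ, ε ≤ |L * κ - m * Real.pi|) → let sh : Literature.MathematicalPhysics.QuantumLattice.FermionTorus 2 L → Fin 2 → Literature.MathematicalPhysics.QuantumLattice.FermionTorus 2 L := fun x μ => toLex (Function.update (ofLex x) μ (ofLex x μ + 1)); let a := fun (x : Literature.MathematicalPhysics.QuantumLattice.FermionTorus 2 L) (σ : Fin 2) => Literature.MathematicalPhysics.QuantumLattice.annihilation (Literature.MathematicalPhysics.QuantumLattice.orb x σ); let H := fun φ : Fin 2 → ℝ => -(∑ x : Literature.MathematicalPhysics.QuantumLattice.FermionTorus 2 L, ∑ μ : Fin 2, ∑ σ : Fin 2, (Complex.exp (Complex.I * (((-1 : ℝ) ^ (σ : ℕ)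 * φ μ / L : ℝ) : ℂ)) • (Matrix.conjTranspose (a x σ) * a (sh x μ) σ) + Complex.exp (-(Complex.I * (((-1 : ℝ) ^ (σ : ℕ) * φ μ / L : ℝ) : ℂ))) • (Matrix.conjTranspose (a (sh x μ) σ) * a x σ))) + (U : ℂ) • ∑ x : Literature.MathematicalPhysics.QuantumLattice.FermionTorus 2 L, Literature.MathematicalPhysics.QuantumLattice.numberOp x 0 * Literature.MathematicalPhysics.QuantumLattice.numberOp x 1; ∃ c : ℝ, 0 < c ∧ c < Real.pi ∧ |Real.cos c - Real.cos (L * κ)| ≤ ε ∧ (∀ φ : Fin 2 → ℝ, 0 ≤ φ 1 → φ 1 ≤ φ 0 → φ 0 ≤ Real.pi → ((∃ ψ₁ ψ₂ : Literature.MathematicalPhysics.QuantumLattice.Fock (Literature.MathematicalPhysics.QuantumLattice.Orb (Literature.MathematicalPhysics.QuantumLattice.FermionTorus 2 L)), Literature.MathematicalPhysics.QuantumLattice.IsGroundStateInSector (H φ) (2 * ⌊(1 - δ) * (L : ℝ) ^ 2 / 2⌋₊) 0 ψ₁ ∧ Literature.MathematicalPhysics.QuantumLattice.IsGroundStateInSector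 (H φ) (2 * ⌊(1 - δ) * (L : ℝ) ^ 2 / 2⌋₊) 0 ψ₂ ∧ star ψ₁ ⬝ᵥ ψ₂ = 0) ↔ (φ 0 = c ∧ φ 1 = c))) ∧ (∃ ψ₁ ψ₂ : Literature.MathematicalPhysics.QuantumLattice.Fock (Literature.MathematicalPhysics.QuantumLattice.Orb (Literature.MathematicalPhysics.QuantumLattice.FermionTorus 2 L)), Literature.MathematicalPhysics.QuantumLattice.IsGroundStateInSector (H (fun _ : Fin 2 => c)) (2 * ⌊(1 - δ) * (L : ℝ) ^ 2 / 2⌋₊) 0 ψ₁ ∧ Literature.MathematicalPhysics.QuantumLattice.IsGroundStateInSector (H (fun _ : Fin 2 => c)) (2 * ⌊(1 - δ) * (L : ℝ) ^ 2 / 2⌋₊) 0 ψ₂ ∧ star ψ₁ ⬝ᵥ ψ₂ = 0 ∧ ∀ χ : Literature.MathematicalPhysics.QuantumLattice.Fock (Literature.MathematicalPhysics.QuantumLattice.Orb (Literature.MathematicalPhysics.QuantumLattice.FermionTorus 2 L)), Literature.MathematicalPhysics.QuantumLattice.IsGroundStateInSector (H (fun _ : Fin 2 => c)) (2 * ⌊(1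 - δ) * (L : ℝ) ^ 2 / 2⌋₊) 0 χ → ∃ z₁ z₂ : ℂ, χ = z₁ • ψ₁ + z₂ • ψ₂) ∧ (∃ m : ℝ, 0 < m ∧ ∃ ρ : ℝ, 0 < ρ ∧ ∀ φ : Fin 2 → ℝ, 0 < (φ 0 - c) ^ 2 + (φ 1 - c) ^ 2 → (φ 0 - c) ^ 2 + (φ 1 - c) ^ 2 ≤ ρ ^ 2 → ∀ ψ χ : Literature.MathematicalPhysics.QuantumLattice.Fock (Literature.MathematicalPhysics.QuantumLattice.Orb (Literature.MathematicalPhysics.QuantumLattice.FermionTorus 2 L)), Literature.MathematicalPhysics.QuantumLattice.IsGroundStateInSector (H φ) (2 * ⌊(1 - δ) * (L : ℝ) ^ 2 / 2⌋₊) 0 ψ → χ ∈ Literature.MathematicalPhysics.QuantumLattice.szSector (2 * ⌊(1 - δ) * (L : ℝ) ^ 2 / 2⌋₊) 0 → star ψ ⬝ᵥ χ = 0 → star χ ⬝ᵥ χ = 1 → Matrix.minEnergyOn (H φ) (Literature.MathematicalPhysics.QuantumLattice.szSector (2 * ⌊(1 - δ) * (L : ℝ) ^ 2 / 2⌋₊)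 0) + m * Real.sqrt ((φ 0 - c) ^ 2 + (φ 1 - c) ^ 2) ≤ (star χ ⬝ᵥ (H φ *ᵥ χ)).re))

end Summit.HubbardSuperconductivity.HubbardSuperconductivity.Theses.NodalDiracTwist.PromotionCheck
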